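import Mathlib.Analysis.Calculus.MeanValue
import Mathlib.Analysis.Calculus.Deriv.Mul
import Mathlib.Analysis.Calculus.Deriv.Star
import Mathlib.Analysis.Complex.RealDeriv
import HarnessLib

/-!
# Complex solutions of a real second-order equation over a real fundamental pair:
# osculating coefficients, conserved flux, and the flux floor ("no cancellation")

Topic `Literature/Analysis/ODE` (namespace `Literature.Analysis.ODE`). For the REAL equation
`y″ = q(x) y` (`q : ℝ → ℝ`, any sign) on an interval `[α, β]`, a COMPLEX solution `u` and two real
solutions `g, d` are tied by constant Wronskians. Elementary consequences, all proved, stated with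
pointwise `HasDerivAt` hypotheses (`u u′ : ℝ → ℂ`, `g g′ d d′ : ℝ → ℝ`):

* `wronskian_complex_real_const` — the osculating coefficient `A = u d′ − u′ d` (a complex
  Wronskian against a real solution) is constant on `[α, β]`; `wronskian_real_const` — so is the
  real Wronskian `W = g d′ − d g′`;
* `mul_wronskian_eq` — the reconstruction identity `(u d′ − u′ d) g + (u′ g − u g′) d = u·W` (pure
  algebra); with canonical data `g(α) = 1, g′(α) = 0, d(α) = 0, d′(α) = 1` this is
  **`u(x) = u(α) g(x) + u′(α) d(x)`** (`eq_data_mul_add`) — no uniqueness theorem is invoked;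
* `flux_const` — the flux `Im(ū u′)` of a complex solution is constant (`(ū u′)′ = |u′|² + q|u|²`
  is real);
* `flux_floor_identity` — the sum-of-squares identity
  `|a||b|·|aG + bD|² − G D·(Im(ā b))² = |a||b|(|a|G − |b|D)² + G D(|a||b| + Re(ā b))²`, hence the
  **flux floor** `G D·(Im(ā b))² ≤ |a||b|·|aG + bD|²` for `G D ≥ 0` (`flux_floor`);
* `flux_floor_of_data` — for a complex solution and the canonical real pair with `g d ≥ 0` on
  `[α, β]` (e.g. `q ≥ 0`, a classically forbidden region, where `g ≥ 1` and `d ≥ 0` by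
  `IsSchrodingerSol.pos_of_nonneg_coeff` of `SchrodingerSturm.lean`):
  `g(x) d(x)·F² ≤ |u(α)| |u′(α)|·|u(x)|²` with `F = Im(ū u′)` the conserved flux — a solution that
  carries flux cannot cancel its growing component;
* `norm_le_of_data` — the trivial companion `|u(x)| ≤ |u(α)||g(x)| + |u′(α)||d(x)|`.

Used toward the cone Green-kernel bound of the near-extremal Kerr programme (barrier algebra for
the horizon / infinity solutions of Carter's radial ODE inside the single barrier).

## References
* P. Hartman, *Ordinary Differential Equations* (SIAM Classics 38, 2002), Ch. XI §2 (Wronskian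
  identities, variation of constants) and §6.
* E. C. Titchmarsh, *Eigenfunction Expansions I*, 2nd ed. (1962), §2.1 and §5.3 (the flux
  `Im(ū u′)` of a complex solution of a real equation; `W(u, ū) = 2i Im(ū u′)`).
-/

noncomputable section

open Set Filter Topology
open scoped ComplexConjugate

namespace Literature.Analysis.ODE

/-! ### Constancy of Wronskians -/

/-- A function with zero derivative at every point of `[α, β]` is constant there. [folklore] -/
theorem eq_of_hasDerivAt_zero {E : Type*} [NormedAddCommGroup E] [NormedSpace ℝ E] {f : ℝ → E}
    {α β : ℝ} (h : ∀ x ∈ Icc α β, HasDerivAt f (0 : E) x) {x : ℝ} (hx : x ∈ Icc α β) :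
    f x = f α :=
  constant_of_has_deriv_right_zero (fun y hy => (h y hy).continuousAt.continuousWithinAt)
    (fun y hy => (h y (Ico_subset_Icc_self hy)).hasDerivWithinAt) x hx

/-- **The Wronskian of a complex and a real solution is constant.** If `u″ = q u` (complex) and
`d″ = q d` (real) on `[α, β]`, then `A = u d′ − u′ d` satisfies `A(x) = A(α)` for `x ∈ [α, β]`.
[folklore] -/
theorem wronskian_complex_real_const {u u' : ℝ → ℂ} {d d' : ℝ → ℝ} {q : ℝ → ℝ} {α β : ℝ}
    (hu : ∀ x ∈ Icc α β, HasDerivAt u (u' x) x ∧ HasDerivAt u' ((q x : ℂ) * u x) x)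
    (hd : ∀ x ∈ Icc α β, HasDerivAt d (d' x) x ∧ HasDerivAt d' (q x * d x) x) {x : ℝ}
    (hx : x ∈ Icc α β) :
    u x * (d' x : ℂ) - u' x * (d x : ℂ) = u α * (d' α : ℂ) - u' α * (d α : ℂ) := by
  refine eq_of_hasDerivAt_zero (f := fun y => u y * (d' y : ℂ) - u' y * (d y : ℂ)) ?_ hx
  intro y hy
  have h1 : HasDerivAt (fun t => (d t : ℂ)) ((d' y : ℝ) : ℂ) y := (hd y hy).1.ofReal_comp
  have h2 : HasDerivAt (fun t => (d' t : ℂ)) ((q y * d y : ℝ) : ℂ) y := (hd y hy).2.ofReal_comp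
  have h := ((hu y hy).1.mul h2).sub ((hu y hy).2.mul h1)
  refine h.congr_deriv ?_
  push_cast
  ring

/-- **The Wronskian of two real solutions is constant**: `W = g d′ − d g′` satisfies `W(x) = W(α)`.
[folklore] -/
theorem wronskian_real_const {g g' d d' : ℝ → ℝ} {q : ℝ → ℝ} {α β : ℝ}
    (hg : ∀ x ∈ Icc α β, HasDerivAt g (g' x) x ∧ HasDerivAt g' (q x * g x) x)
    (hd : ∀ x ∈ Icc α β, HasDerivAt d (d' x) x ∧ HasDerivAt d' (q x * d x) x) {x : ℝ}
    (hx : x ∈ Icc α β) :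
    g x * d' x - d x * g' x = g α * d' α - d α * g' α := by
  refine eq_of_hasDerivAt_zero (f := fun y => g y * d' y - d y * g' y) ?_ hx
  intro y hy
  have h := ((hg y hy).1.mul (hd y hy).2).sub ((hd y hy).1.mul (hg y hy).2)
  refine h.congr_deriv ?_
  ring

/-! ### Reconstruction over the canonical pair -/

/-- The algebra of variation of constants: `(u d′ − u′ d) g + (u′ g − u g′) d = u (g d′ − d g′)`.
[folklore] -/
theorem mul_wronskian_eq (u u' g g' d d' : ℂ) :
    (u * d' - u' * d) * g + (u' * g - u * g') * d = u * (g * d' - d * g') := by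
  ring

/-- **`u = u(α)·g + u′(α)·d` over the canonical real pair.** If `u″ = q u` (complex) and `g, d` are
the real solutions with data `g(α) = 1, g′(α) = 0`, `d(α) = 0, d′(α) = 1`, all on `[α, β]`, then
`u(x) = u(α) g(x) + u′(α) d(x)` and `u′(x) = u(α) g′(x) + u′(α) d′(x)` for `x ∈ [α, β]` (constancy
of the three Wronskians; no uniqueness theorem needed). [folklore] -/
theorem eq_data_mul_add {u u' : ℝ → ℂ} {g g' d d' : ℝ → ℝ} {q : ℝ → ℝ} {α β : ℝ}
    (hu : ∀ x ∈ Icc α β, HasDerivAt u (u' x) x ∧ HasDerivAt u' ((q x : ℂ) * u x) x)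
    (hg : ∀ x ∈ Icc α β, HasDerivAt g (g' x) x ∧ HasDerivAt g' (q x * g x) x)
    (hd : ∀ x ∈ Icc α β, HasDerivAt d (d' x) x ∧ HasDerivAt d' (q x * d x) x)
    (hg0 : g α = 1) (hg1 : g' α = 0) (hd0 : d α = 0) (hd1 : d' α = 1) {x : ℝ}
    (hx : x ∈ Icc α β) :
    u x = u α * (g x : ℂ) + u' α * (d x : ℂ) ∧ u' x = u α * (g' x : ℂ) + u' α * (d' x : ℂ) := by
  -- the three constant Wronskians, evaluated at `α`
  have hA := wronskian_complex_real_const hu hd hx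
  have hB := wronskian_complex_real_const hu hg hx
  have hW := wronskian_real_const hg hd hx
  rw [hg0, hg1, hd0, hd1] at *
  simp only [Complex.ofReal_one, Complex.ofReal_zero, mul_one, mul_zero, sub_zero, zero_sub] at hA hB hW
  -- `hA : u x * d' x - u' x * d x = u α`, `hB : u x * g' x - u' x * g x = -u' α`, `hW : g d' − d g' = 1`
  have hW' : (g x : ℂ) * (d' x : ℂ) - (d x : ℂ) * (g' x : ℂ) = 1 := by exact_mod_cast hW
  constructor
  · have e := mul_wronskian_eq (u x) (u' x) (g x) (g' x) (d x) (d' x)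
    rw [hW', mul_one] at e
    rw [← e, hA]
    have : u' x * ↑(g x) - u x * ↑(g' x) = u' α := by linear_combination -hB
    rw [this]
  · -- differentiate-free: solve the linear system `hA`, `hB` for `u' x` using `hW'`
    have e : u' x * ((g x : ℂ) * (d' x : ℂ) - (d x : ℂ) * (g' x : ℂ)) =
        (u x * (d' x : ℂ) - u' x * (d x : ℂ)) * (g' x : ℂ) +
          (u' x * (g x : ℂ) - u x * (g' x : ℂ)) * (d' x : ℂ) := by ring
    rw [hW', mul_one, hA] at e
    rw [e]
    have : u' x * ↑(g x) - u x * ↑(g' x) = u' α := by linear_combination -hB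
    rw [this]

/-- **Upper bound over the canonical pair**: `|u(x)| ≤ |u(α)|·|g(x)| + |u′(α)|·|d(x)|`. [folklore] -/
theorem norm_le_of_data {u u' : ℝ → ℂ} {g g' d d' : ℝ → ℝ} {q : ℝ → ℝ} {α β : ℝ}
    (hu : ∀ x ∈ Icc α β, HasDerivAt u (u' x) x ∧ HasDerivAt u' ((q x : ℂ) * u x) x)
    (hg : ∀ x ∈ Icc α β, HasDerivAt g (g' x) x ∧ HasDerivAt g' (q x * g x) x)
    (hd : ∀ x ∈ Icc α β, HasDerivAt d (d' x) x ∧ HasDerivAt d' (q x * d x) x)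
    (hg0 : g α = 1) (hg1 : g' α = 0) (hd0 : d α = 0) (hd1 : d' α = 1) {x : ℝ}
    (hx : x ∈ Icc α β) :
    ‖u x‖ ≤ ‖u α‖ * |g x| + ‖u' α‖ * |d x| := by
  rw [(eq_data_mul_add hu hg hd hg0 hg1 hd0 hd1 hx).1]
  calc ‖u α * (g x : ℂ) + u' α * (d x : ℂ)‖ ≤ ‖u α * (g x : ℂ)‖ + ‖u' α * (d x : ℂ)‖ := norm_add_le _ _
    _ = ‖u α‖ * |g x| + ‖u' α‖ * |d x| := by
        rw [norm_mul, norm_mul, Complex.norm_real, Complex.norm_real, Real.norm_eq_abs,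
          Real.norm_eq_abs]

/-! ### The conserved flux `Im(ū u′)` -/

/-- **Flux conservation**: for a complex solution of the REAL equation `u″ = q u` on `[α, β]`,
`Im(conj(u(x))·u′(x)) = Im(conj(u(α))·u′(α))` for `x ∈ [α, β]` (`(ū u′)′ = |u′|² + q|u|²` is real).
[folklore] -/
theorem flux_const {u u' : ℝ → ℂ} {q : ℝ → ℝ} {α β : ℝ}
    (hu : ∀ x ∈ Icc α β, HasDerivAt u (u' x) x ∧ HasDerivAt u' ((q x : ℂ) * u x) x) {x : ℝ}
    (hx : x ∈ Icc α β) :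
    (conj (u x) * u' x).im = (conj (u α) * u' α).im := by
  refine eq_of_hasDerivAt_zero (f := fun y => (conj (u y) * u' y).im) ?_ hx
  intro y hy
  have hc : HasDerivAt (fun t => conj (u t)) (conj (u' y)) y := (hu y hy).1.star
  have hprod : HasDerivAt (fun t => conj (u t) * u' t)
      (conj (u' y) * u' y + conj (u y) * ((q y : ℂ) * u y)) y := hc.mul (hu y hy).2
  have him : HasDerivAt (fun t => (conj (u t) * u' t).im)
      ((conj (u' y) * u' y + conj (u y) * ((q y : ℂ) * u y)).im) y :=
    Complex.imCLM.hasFDerivAt.comp_hasDerivAt y hprod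
  refine him.congr_deriv ?_
  have e1 : (conj (u' y) * u' y).im = 0 := by
    rw [Complex.conj_mul', ← Complex.ofReal_pow, Complex.ofReal_im]
  have e2 : (conj (u y) * ((q y : ℂ) * u y)).im = 0 := by
    have : conj (u y) * ((q y : ℂ) * u y) = (q y : ℂ) * (conj (u y) * u y) := by ring
    rw [this, Complex.conj_mul', ← Complex.ofReal_pow, ← Complex.ofReal_mul, Complex.ofReal_im]
  rw [Complex.add_im, e1, e2, add_zero]

/-- The flux of a combination `a g + b d` of REAL functions at a point where `g d′ − d g′ = W`:
`Im(conj(a g + b d)·(a g′ + b d′)) = Im(ā b)·W`. [folklore] -/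
theorem flux_of_combination (a b : ℂ) (g g' d d' : ℝ) :
    (conj (a * g + b * d) * (a * g' + b * d')).im = (conj a * b).im * (g * d' - d * g') := by
  simp only [map_add, map_mul, Complex.conj_ofReal, Complex.add_im, Complex.mul_im, Complex.mul_re,
    Complex.add_re, Complex.conj_re, Complex.conj_im, Complex.ofReal_re, Complex.ofReal_im]
  ring

/-! ### The flux floor: a solution carrying flux cannot cancel its growing component -/

/-- **Sum-of-squares identity behind the flux floor**: for complex `a, b` and real `G, D`,
`|a||b|·|aG + bD|² − G D (Im(ā b))² = |a||b| (|a| G − |b| D)² + G D (|a||b| + Re(ā b))²`.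
[folklore] -/
theorem flux_floor_identity (a b : ℂ) (G D : ℝ) :
    ‖a‖ * ‖b‖ * ‖a * G + b * D‖ ^ 2 - G * D * (conj a * b).im ^ 2 =
      ‖a‖ * ‖b‖ * (‖a‖ * G - ‖b‖ * D) ^ 2 + G * D * (‖a‖ * ‖b‖ + (conj a * b).re) ^ 2 := by
  -- `|ā b|² = Re² + Im²` and `|ā b| = |a||b|`
  have hn : ‖a‖ ^ 2 * ‖b‖ ^ 2 = (conj a * b).re ^ 2 + (conj a * b).im ^ 2 := by
    have h1 : ‖conj a * b‖ ^ 2 = (conj a * b).re ^ 2 + (conj a * b).im ^ 2 := by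
      rw [Complex.sq_norm, Complex.normSq_apply]; ring
    rw [← h1, norm_mul, Complex.norm_conj, mul_pow]
  -- `|aG + bD|² = |a|²G² + |b|²D² + 2 G D Re(ā b)`
  have hs : ‖a * G + b * D‖ ^ 2 = ‖a‖ ^ 2 * G ^ 2 + ‖b‖ ^ 2 * D ^ 2 + 2 * G * D * (conj a * b).re := by
    simp only [Complex.sq_norm, Complex.normSq_apply, Complex.add_re, Complex.add_im, Complex.mul_re,
      Complex.mul_im, Complex.ofReal_re, Complex.ofReal_im, Complex.conj_re, Complex.conj_im]
    ring
  rw [hs]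
  linear_combination G * D * hn

/-- **Flux floor**: for complex `a, b` and reals `G, D` with `G D ≥ 0`,
`G D·(Im(ā b))² ≤ |a||b|·|aG + bD|²`. [folklore] -/
theorem flux_floor (a b : ℂ) {G D : ℝ} (hGD : 0 ≤ G * D) :
    G * D * (conj a * b).im ^ 2 ≤ ‖a‖ * ‖b‖ * ‖a * G + b * D‖ ^ 2 := by
  have h := flux_floor_identity a b G D
  have h1 : 0 ≤ ‖a‖ * ‖b‖ * (‖a‖ * G - ‖b‖ * D) ^ 2 := by positivity
  have h2 : 0 ≤ G * D * (‖a‖ * ‖b‖ + (conj a * b).re) ^ 2 := mul_nonneg hGD (sq_nonneg _)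
  linarith

/-- **Flux floor for a complex solution in a region where the canonical pair is non-negative.**
Let `u″ = q u` (complex) and `g, d` the canonical real pair at `α` on `[α, β]`, with
`g(x) d(x) ≥ 0` at the point `x ∈ [α, β]` (automatic on `[α, β]` when `q ≥ 0` there). Then
`g(x) d(x)·(Im(conj(u(x)) u′(x)))² ≤ |u(α)|·|u′(α)|·|u(x)|²`: the conserved flux forces the modulus
to grow at least like `√(g d)·|F|/√(|u(α)||u′(α)|)`. [folklore] -/
theorem flux_floor_of_data {u u' : ℝ → ℂ} {g g' d d' : ℝ → ℝ} {q : ℝ → ℝ} {α β : ℝ}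
    (hu : ∀ x ∈ Icc α β, HasDerivAt u (u' x) x ∧ HasDerivAt u' ((q x : ℂ) * u x) x)
    (hg : ∀ x ∈ Icc α β, HasDerivAt g (g' x) x ∧ HasDerivAt g' (q x * g x) x)
    (hd : ∀ x ∈ Icc α β, HasDerivAt d (d' x) x ∧ HasDerivAt d' (q x * d x) x)
    (hg0 : g α = 1) (hg1 : g' α = 0) (hd0 : d α = 0) (hd1 : d' α = 1) {x : ℝ}
    (hx : x ∈ Icc α β) (hgd : 0 ≤ g x * d x) :
    g x * d x * (conj (u x) * u' x).im ^ 2 ≤ ‖u α‖ * ‖u' α‖ * ‖u x‖ ^ 2 := by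
  rw [flux_const hu hx, (eq_data_mul_add hu hg hd hg0 hg1 hd0 hd1 hx).1]
  exact flux_floor (u α) (u' α) hgd

/-- **Flux floor, flux form**: under the same hypotheses, with the flux `F = Im(conj(u(α)) u′(α))`
read off at `α`: `g(x) d(x)·F² ≤ |u(α)|·|u′(α)|·|u(x)|²`. [folklore] -/
theorem flux_floor_of_data' {u u' : ℝ → ℂ} {g g' d d' : ℝ → ℝ} {q : ℝ → ℝ} {α β : ℝ}
    (hu : ∀ x ∈ Icc α β, HasDerivAt u (u' x) x ∧ HasDerivAt u' ((q x : ℂ) * u x) x)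
    (hg : ∀ x ∈ Icc α β, HasDerivAt g (g' x) x ∧ HasDerivAt g' (q x * g x) x)
    (hd : ∀ x ∈ Icc α β, HasDerivAt d (d' x) x ∧ HasDerivAt d' (q x * d x) x)
    (hg0 : g α = 1) (hg1 : g' α = 0) (hd0 : d α = 0) (hd1 : d' α = 1) {x : ℝ}
    (hx : x ∈ Icc α β) (hgd : 0 ≤ g x * d x) :
    g x * d x * (conj (u α) * u' α).im ^ 2 ≤ ‖u α‖ * ‖u' α‖ * ‖u x‖ ^ 2 := by
  rw [← flux_const hu hx]
  exact flux_floor_of_data hu hg hd hg0 hg1 hd0 hd1 hx hgd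

end Literature.Analysis.ODE

end
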